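import Literature.AlgebraicGeometry.Hyperkaehler.K3HilbertType
import Literature.AlgebraicGeometry.Surfaces.K3SurfaceProofs
import Literature.AlgebraicGeometry.Surfaces.K3NikulinInvolution
import HarnessLib

/-!
# Route NikulinTwinTransport · crux X = `TwinSimilitudeAlgebraic` (stmt-HodgeConjecture-13674) —
# line `hyperkaehler-nikulin-anchors`, heart assembly: ALGEBRA OF THE `K3^{[2]}` LATTICE FORM

Pure lattice algebra for the form `q = k3HilbertForm 2` of `Λ_{K3} ⊕ ⟨−2⟩` on `ℂ²³`
(`K3HilbertIndex = K3Index ⊕ Unit`), consumed by the heart `HKTwinClassAssembly` of the line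
(`Cruxes/TwinSimilitudeAlgebraic/Lines/hyperkaehler_nikulin_anchors.lean`, reshape r2) to transport
the LATTICE DATUM of `HKLatticeWitt` (a rational isometry `g` of `(Λ_{K3} ⊕ ⟨−2⟩)_ℚ` with
`g_ℂ(x, 0) = z`) through the markings:

* `k3HilbertForm_eq_dotProduct`, `k3HilbertForm_mulVec_mulVec`, bilinearity and symmetry of `q`;
* `k3HilbertForm_elim_elim` — the block formula `q((a, c), (b, d)) = (a.b) + (2 − 2n) c d`;
* `k3HilbertForm_ratMatrix_of_basis` — a rational matrix which is `q`-isometric on the rational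
  points is `q`-isometric on all of `ℂ²³`;
* the lattice-side TRANSCENDENTAL SPACES `Tr₂[w ; z]` / `Tr[w ; x]` (local notations, verbatim those
  of the Literature facts `CamereEtAl2023_fixedK3_restriction`): transport under a rational isometry
  with rational inverse (`tr₂_mulVec_of_tr₂`), the `δ`-component of a vector transcendental for a
  Hilbert-square period `(x, 0)` vanishes (`apply_inr_eq_zero_of_tr₂_elim`), and
  `Tr₂[(w, 0) ; (x, 0)] ↔ Tr[w ; x]` (`tr₂_elim_iff_tr`).

No definitions, no named facts. Prover seat prover-line-stmt-HodgeConjecture-13674-c1-0 (line lead).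

## References

* [Beauville1983] A. Beauville, J. Differential Geom. 18 (1983), §6 Prop. 6 and §9 Rem. 1
  (`H²(S^{[2]}, ℤ) = i(H²(S, ℤ)) ⊕ ℤδ`, `q(δ) = −2`).
* [Huybrechts2016K3] D. Huybrechts, Lectures on K3 Surfaces, CUP 2016, Ch. 3 Def. 2.5 and
  Lemma 3.1 (transcendental lattice).
-/

noncomputable section

set_option linter.dupNamespace false

open scoped Matrix
open Literature.AlgebraicGeometry.Surfaces Literature.AlgebraicGeometry.Hyperkaehler

namespace Summit.HodgeConjecture.HodgeConjecture.Theorems.NikulinTwinTransport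

/-- `Tr₂[w ; z]`: `w ∈ ℂ²³` is `q`-orthogonal to every rational vector `q`-orthogonal to `z`
(`w ∈ T(z)_ℚ ⊗ ℂ`). Local notation, verbatim that of `Hyperkaehler.CamereEtAl2023_fixedK3_restriction`. -/
local notation3 (prettyPrint := false) "Tr₂[" w " ; " z "]" =>
  (∀ v : K3HilbertIndex → ℚ, k3HilbertForm 2 (fun i => ((v i : ℚ) : ℂ)) z = 0 →
    k3HilbertForm 2 (fun i => ((v i : ℚ) : ℂ)) w = 0)

/-- `Tr[w ; x]`: the same for the K3 lattice. Local notation, verbatim that of the Literature fact. -/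
local notation3 (prettyPrint := false) "Tr[" w " ; " x "]" =>
  (∀ v : K3Index → ℚ, k3Form (fun i => ((v i : ℚ) : ℂ)) x = 0 → k3Form (fun i => ((v i : ℚ) : ℂ)) w = 0)

/-! ### `q` as a matrix form; bilinearity and symmetry -/

/-- `q(a, b) = a ⬝ (G b)` with `G` the Gram matrix of `Λ_{K3} ⊕ ⟨2 − 2n⟩`. [folklore] -/
theorem k3HilbertForm_eq_dotProduct (n : ℕ) (a b : K3HilbertIndex → ℂ) :
    k3HilbertForm n a b = a ⬝ᵥ ((k3HilbertGram n).map (Int.cast : ℤ → ℂ) *ᵥ b) := by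
  simp only [k3HilbertForm, dotProduct, Matrix.mulVec, Matrix.map_apply, Finset.mul_sum, mul_assoc]

/-- The form of two matrix images: `q(M a, M b) = a ⬝ (Mᵀ G M) b`. [folklore] -/
theorem k3HilbertForm_mulVec_mulVec (n : ℕ) (M : Matrix K3HilbertIndex K3HilbertIndex ℂ)
    (a b : K3HilbertIndex → ℂ) :
    k3HilbertForm n (M *ᵥ a) (M *ᵥ b) =
      a ⬝ᵥ ((Mᵀ * (k3HilbertGram n).map (Int.cast : ℤ → ℂ) * M) *ᵥ b) := by
  rw [k3HilbertForm_eq_dotProduct, ← Matrix.vecMul_transpose M a]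
  simp only [Matrix.dotProduct_mulVec, Matrix.vecMul_vecMul, Matrix.mul_assoc]

/-- `q` is additive in the first argument. [folklore] -/
theorem k3HilbertForm_add_left (n : ℕ) (a a' b : K3HilbertIndex → ℂ) :
    k3HilbertForm n (a + a') b = k3HilbertForm n a b + k3HilbertForm n a' b := by
  simp only [k3HilbertForm_eq_dotProduct, add_dotProduct]

/-- `q` is additive in the second argument. [folklore] -/
theorem k3HilbertForm_add_right (n : ℕ) (a b b' : K3HilbertIndex → ℂ) :
    k3HilbertForm n a (b + b') = k3HilbertForm n a b + k3HilbertForm n a b' := by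
  simp only [k3HilbertForm_eq_dotProduct, Matrix.mulVec_add, dotProduct_add]

/-- `q` is homogeneous in the first argument. [folklore] -/
theorem k3HilbertForm_smul_left (n : ℕ) (t : ℂ) (a b : K3HilbertIndex → ℂ) :
    k3HilbertForm n (t • a) b = t * k3HilbertForm n a b := by
  simp only [k3HilbertForm_eq_dotProduct, smul_dotProduct, smul_eq_mul]

/-- `q` is homogeneous in the second argument. [folklore] -/
theorem k3HilbertForm_smul_right (n : ℕ) (t : ℂ) (a b : K3HilbertIndex → ℂ) :
    k3HilbertForm n a (t • b) = t * k3HilbertForm n a b := by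
  simp only [k3HilbertForm_eq_dotProduct, Matrix.mulVec_smul, dotProduct_smul, smul_eq_mul]

/-- `q(0, b) = 0`. [folklore] -/
theorem k3HilbertForm_zero_left (n : ℕ) (b : K3HilbertIndex → ℂ) : k3HilbertForm n 0 b = 0 := by
  simp only [k3HilbertForm_eq_dotProduct, zero_dotProduct]

/-- `q(a, 0) = 0`. [folklore] -/
theorem k3HilbertForm_zero_right (n : ℕ) (a : K3HilbertIndex → ℂ) : k3HilbertForm n a 0 = 0 := by
  simp only [k3HilbertForm_eq_dotProduct, Matrix.mulVec_zero, dotProduct_zero]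

/-- `q` of a finite sum in the second argument. [folklore] -/
theorem k3HilbertForm_sum_right (n : ℕ) {κ : Type} (s : Finset κ) (a : K3HilbertIndex → ℂ)
    (b : κ → K3HilbertIndex → ℂ) :
    k3HilbertForm n a (∑ l ∈ s, b l) = ∑ l ∈ s, k3HilbertForm n a (b l) := by
  classical
  induction s using Finset.induction_on with
  | empty => simp [k3HilbertForm_zero_right]
  | insert x s hx ih => rw [Finset.sum_insert hx, Finset.sum_insert hx, k3HilbertForm_add_right, ih]

/-- `q` is symmetric (the Gram matrix is). [folklore] -/
theorem k3HilbertForm_comm (n : ℕ) (a b : K3HilbertIndex → ℂ) :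
    k3HilbertForm n a b = k3HilbertForm n b a := by
  have hGt : ((k3HilbertGram n).map (Int.cast : ℤ → ℂ))ᵀ = (k3HilbertGram n).map (Int.cast : ℤ → ℂ) := by
    rw [← Matrix.transpose_map, k3HilbertGram_transpose]
  rw [k3HilbertForm_eq_dotProduct, k3HilbertForm_eq_dotProduct, Matrix.dotProduct_mulVec,
    ← Matrix.mulVec_transpose, hGt, dotProduct_comm]

/-- The BLOCK FORMULA `q((a, c), (b, d)) = (a.b) + (2 − 2n) · c d` of `Λ_{K3} ⊕ ⟨2 − 2n⟩`.
[cite: Beauville1983, §9 Rem. 1] -/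
theorem k3HilbertForm_elim_elim (n : ℕ) (a b : K3Index → ℂ) (c d : Unit → ℂ) :
    k3HilbertForm n (Sum.elim a c) (Sum.elim b d) =
      k3Form a b + (2 - 2 * (n : ℂ)) * (c () * d ()) := by
  simp only [k3HilbertForm, k3Form, Fintype.sum_sum_type, Sum.elim_inl, Sum.elim_inr,
    k3HilbertGram_inl_inl, k3HilbertGram_inl_inr, k3HilbertGram_inr_inl, k3HilbertGram_inr_inr,
    Int.cast_zero, mul_zero, zero_mul, Finset.sum_const_zero, add_zero, zero_add,
    Fintype.sum_unique, Int.cast_sub, Int.cast_mul, Int.cast_ofNat, Int.cast_natCast]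
  ring

/-- `q((a, c), (b, 0)) = (a.b)`: a vector with vanishing `δ`-component pairs through the K3 form.
[cite: Beauville1983, §9 Lemme 1] -/
theorem k3HilbertForm_elim_elim_zero (n : ℕ) (a b : K3Index → ℂ) (c : Unit → ℂ) :
    k3HilbertForm n (Sum.elim a c) (Sum.elim b 0) = k3Form a b := by
  rw [k3HilbertForm_elim_elim]; simp

/-- `q((a, 0), (b, d)) = (a.b)`. [cite: Beauville1983, §9 Lemme 1] -/
theorem k3HilbertForm_elim_zero_elim (n : ℕ) (a b : K3Index → ℂ) (d : Unit → ℂ) :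
    k3HilbertForm n (Sum.elim a 0) (Sum.elim b d) = k3Form a b := by
  rw [k3HilbertForm_elim_elim]; simp

/-- `q(e_δ, w) = (2 − 2n) w_δ` for the last basis vector `e_δ`. [cite: Beauville1983, §9 Rem. 1] -/
theorem k3HilbertForm_single_inr_left (n : ℕ) (w : K3HilbertIndex → ℂ) :
    k3HilbertForm n (Pi.single (Sum.inr ()) 1) w = (2 - 2 * (n : ℂ)) * w (Sum.inr ()) := by
  rw [k3HilbertForm_eq_dotProduct, single_one_dotProduct, Matrix.mulVec, dotProduct,
    Fintype.sum_sum_type]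
  simp [Matrix.map_apply, k3HilbertGram_inr_inl, k3HilbertGram_inr_inr]

/-! ### Casts, conjugation and `Sum.elim` -/

/-- A rational vector of `ℚ²³` with components `(v, d)` casts to `((v : ℂ²²), (d : ℂ))`. [folklore] -/
theorem ratCast_sum_elim (v : K3Index → ℚ) (d : Unit → ℚ) :
    (fun i => ((Sum.elim v d i : ℚ) : ℂ)) = Sum.elim (fun i => ((v i : ℚ) : ℂ)) (fun u => ((d u : ℚ) : ℂ)) := by
  funext i; rcases i with i | u <;> rfl

/-- Every rational vector of `ℚ²³` is `(v, d)`. [folklore] -/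
theorem ratCast_eq_sum_elim (V : K3HilbertIndex → ℚ) :
    (fun i => ((V i : ℚ) : ℂ)) =
      Sum.elim (fun i => ((V (Sum.inl i) : ℚ) : ℂ)) (fun u => ((V (Sum.inr u) : ℚ) : ℂ)) := by
  funext i; rcases i with i | u <;> rfl

/-- Conjugation of `(x, 0)` is `(x̄, 0)`. [folklore] -/
theorem star_sum_elim_zero (x : K3Index → ℂ) :
    star (Sum.elim x (0 : Unit → ℂ)) = Sum.elim (star x) 0 := by
  funext i; rcases i with i | u <;> simp

/-- A vector with vanishing `δ`-component is `(w ∘ inl, 0)`. [folklore] -/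
theorem eq_sum_elim_of_apply_inr_eq_zero {w : K3HilbertIndex → ℂ} (h : w (Sum.inr ()) = 0) :
    w = Sum.elim (fun i => w (Sum.inl i)) 0 := by
  funext i; rcases i with i | u
  · rfl
  · rcases u; simpa using h

/-- The integral standard basis of `ℚ²³` casts to the standard basis of `ℂ²³`. [folklore] -/
theorem ratCast_single (j : K3HilbertIndex) :
    (fun i => (((Pi.single j (1 : ℚ) : K3HilbertIndex → ℚ) i : ℚ) : ℂ)) = Pi.single j 1 := by
  funext i
  by_cases h : i = j
  · subst h; simp
  · simp [h]

/-! ### A rational isometry of the rational points is an isometry of `ℂ²³` -/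

/-- **A rational matrix which is `q`-isometric on `ℚ²³` is `q`-isometric on `ℂ²³`**: if
`q(M v, M w) = q(v, w)` for all rational `v, w` then `Mᵀ G M = G`, hence the identity for all
complex vectors. [folklore] -/
theorem k3HilbertForm_ratMatrix_of_basis (n : ℕ) (M : Matrix K3HilbertIndex K3HilbertIndex ℚ)
    (hM : ∀ v w : K3HilbertIndex → ℚ,
      k3HilbertForm n (M.map (fun q : ℚ => (q : ℂ)) *ᵥ fun i => ((v i : ℚ) : ℂ))
          (M.map (fun q : ℚ => (q : ℂ)) *ᵥ fun i => ((w i : ℚ) : ℂ)) =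
        k3HilbertForm n (fun i => ((v i : ℚ) : ℂ)) (fun i => ((w i : ℚ) : ℂ)))
    (a b : K3HilbertIndex → ℂ) :
    k3HilbertForm n (M.map (fun q : ℚ => (q : ℂ)) *ᵥ a) (M.map (fun q : ℚ => (q : ℂ)) *ᵥ b) =
      k3HilbertForm n a b := by
  set MC : Matrix K3HilbertIndex K3HilbertIndex ℂ := M.map (fun q : ℚ => (q : ℂ)) with hMC
  set GC : Matrix K3HilbertIndex K3HilbertIndex ℂ := (k3HilbertGram n).map (Int.cast : ℤ → ℂ)
    with hGC
  -- the matrix identity `MCᵀ G MC = G`, entry by entry from the rational basis vectors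
  have hmat : MCᵀ * GC * MC = GC := by
    ext i j
    have h := hM (Pi.single i 1) (Pi.single j 1)
    rw [ratCast_single, ratCast_single, k3HilbertForm_mulVec_mulVec, k3HilbertForm_eq_dotProduct]
      at h
    simpa only [Matrix.mulVec_single_one, single_one_dotProduct, Matrix.col_apply] using h
  rw [k3HilbertForm_mulVec_mulVec, hmat, ← k3HilbertForm_eq_dotProduct]

/-! ### Transport of the transcendental spaces -/

/-- **Transcendental spaces are transported by a rational isometry with rational inverse**: if
`M` (rational, `q`-isometric on `ℂ²³`) has the rational two-sided inverse `M'`, then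
`w ∈ T(y) ⊗ ℂ` implies `M w ∈ T(M y) ⊗ ℂ`. [cite: Huybrechts2016K3, Ch. 3 Lemma 3.1] -/
theorem tr₂_mulVec_of_tr₂ (M M' : Matrix K3HilbertIndex K3HilbertIndex ℚ) (hMM' : M * M' = 1)
    (hiso : ∀ a b : K3HilbertIndex → ℂ,
      k3HilbertForm 2 (M.map (fun q : ℚ => (q : ℂ)) *ᵥ a) (M.map (fun q : ℚ => (q : ℂ)) *ᵥ b) =
        k3HilbertForm 2 a b)
    {w y : K3HilbertIndex → ℂ} (hw : Tr₂[w ; y]) :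
    Tr₂[M.map (fun q : ℚ => (q : ℂ)) *ᵥ w ; M.map (fun q : ℚ => (q : ℂ)) *ᵥ y] := by
  intro V hV
  -- `V = M (M' V)` with `M' V` rational
  have hVM : (fun i => ((V i : ℚ) : ℂ)) =
      M.map (fun q : ℚ => (q : ℂ)) *ᵥ fun i => (((M' *ᵥ V) i : ℚ) : ℂ) := by
    rw [← ratCast_map_mulVec_ratCast' (M₀ := M) (v := M' *ᵥ V), Matrix.mulVec_mulVec, hMM',
      Matrix.one_mulVec]
  rw [hVM, hiso] at hV ⊢
  exact hw _ hV
where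
  /-- local restatement of `ratCast_map_mulVec_ratCast` (file `HKMarkedSqLemmas`) to keep this
  file's imports lattice-only. [folklore] -/
  ratCast_map_mulVec_ratCast' {M₀ : Matrix K3HilbertIndex K3HilbertIndex ℚ} {v : K3HilbertIndex → ℚ} :
      (fun i => (((M₀ *ᵥ v) i : ℚ) : ℂ)) = (M₀.map (fun q : ℚ => (q : ℂ))) *ᵥ fun i => ((v i : ℚ) : ℂ) := by
    funext i
    simp only [Matrix.mulVec, dotProduct, Matrix.map_apply, Rat.cast_sum, Rat.cast_mul]

/-- **The `δ`-component of a vector transcendental for a Hilbert-square period `(x, 0)` vanishes**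
(`δ` is rational and `q`-orthogonal to `(x, 0)`, and `q(δ) = −2 ≠ 0`). [cite: Beauville1983, §9 Rem. 1] -/
theorem apply_inr_eq_zero_of_tr₂_elim {w : K3HilbertIndex → ℂ} {x : K3Index → ℂ}
    (hw : Tr₂[w ; Sum.elim x 0]) : w (Sum.inr ()) = 0 := by
  have h := hw (Pi.single (Sum.inr ()) 1) ?_
  · rw [ratCast_single, k3HilbertForm_single_inr_left] at h
    have h2 : (2 - 2 * ((2 : ℕ) : ℂ)) ≠ 0 := by norm_num
    exact (mul_eq_zero.1 h).resolve_left h2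
  · rw [ratCast_single, k3HilbertForm_single_inr_left]
    simp

/-- **`Tr₂[(w, 0) ; (x, 0)] ↔ Tr[w ; x]`**: for vectors and periods in the `Λ_{K3}`-summand the
`K3^{[2]}` transcendental condition is the K3 one (block formula). [cite: Beauville1983, §9 Lemme 1]
[cite: Huybrechts2016K3, Ch. 3 Def. 2.5] -/
theorem tr₂_elim_iff_tr (w x : K3Index → ℂ) :
    Tr₂[Sum.elim w 0 ; Sum.elim x 0] ↔ Tr[w ; x] := by
  constructor
  · intro h v hv
    have h' := h (Sum.elim v 0) ?_
    · rw [ratCast_sum_elim, k3HilbertForm_elim_elim_zero] at h'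
      simpa using h'
    · rw [ratCast_sum_elim, k3HilbertForm_elim_elim_zero]
      simpa using hv
  · intro h V hV
    rw [ratCast_eq_sum_elim V, k3HilbertForm_elim_elim_zero] at hV ⊢
    exact h _ hV

/-- `Tr₂` is a linear condition: closed under scalars. [folklore] -/
theorem tr₂_smul {w z : K3HilbertIndex → ℂ} (hw : Tr₂[w ; z]) (t : ℂ) : Tr₂[t • w ; z] :=
  fun v hv => by rw [k3HilbertForm_smul_right, hw v hv, mul_zero]

/-- The period itself is transcendental: `Tr₂[z ; z]`. [folklore] -/
theorem tr₂_self (z : K3HilbertIndex → ℂ) : Tr₂[z ; z] := fun _ hv => hv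

/-- Registered anchor of this helper file (closed form of `tr₂_elim_iff_tr`).
[cite: Beauville1983, §9 Lemme 1] -/
theorem hkLatticeTransport_anchor : ∀ (w x : K3Index → ℂ), Tr₂[Sum.elim w 0 ; Sum.elim x 0] ↔ Tr[w ; x] :=
  fun w x => tr₂_elim_iff_tr w x

end Summit.HodgeConjecture.HodgeConjecture.Theorems.NikulinTwinTransport

end
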